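import Literature.NumberTheory.EllipticCurves.BertoliniDarmonPrasanna2013.WaldspurgerHeegnerPoints
import Summits.BirchSwinnertonDyer.BirchSwinnertonDyer.Theorems.ClassRecordThreeHsiehDescentKernelOfWaldspurger
import HarnessLib

/-!
# Routes `ClassRecordThree` ∕ `KolyvaginRoadThree` — THE «HSIEH DOWN» KERNEL read at the FINEST trust base: the bodies of
# `HsiehDescentAtThree` (item 19108) and `OpenValueReciprocityAtThree` (19281), THESES-FREE, from the two printed ATOMS of
# BDP13 (5.1.16) — Thm. 5.4 (5.1.12) at the tree's Heegner points and Shimura's CM algebraicity (Prop. 1.12 (1))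

Cell `bsd-stepL` (run/shared/lean/pub/bsd-stepL/), seat `bsd-stepL-desc3-p1x` (WIDTH-LEVER second prover lane, session g2),
`--supports stmt-BirchSwinnertonDyer-19108`. Sequel of `ClassRecordThreeHsiehDescentKernelOfWaldspurger.lean` (the planner's
RULING 21 (A) kernel `WaldspurgerKernel.hsiehDescentAt₃_of_thm54_of_tateSen`). This seat's g0 session ATOMISED the square-root
fact `thm54_bdpLalg_eq_sq_sum_cmValues` into the two Literature atoms of `BertoliniDarmonPrasanna2013/WaldspurgerHeegnerPoints.lean`
(p533067) and derived it from them (`Theorems.thm54_bdpLalg_eq_sq_sum_cmValues_of_atoms`, p536013) — but in a module that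
imports route files (via p531052), hence unusable inside `closes`. Here the same derivation is re-homed (PRIVATE copy, same
proof; the gate's dedup rule forbids a public restatement) and composed with the Theses-free kernel:

* `WaldspurgerKernel.hsiehDescentAt₃_of_atoms_of_tateSen (h54) (h112) (hTS) : <BODY of 19108 verbatim>` — the crux from
  {Thm. 5.4 at Heegner points, Shimura's algebraicity, Tate–Sen at 3} BY NAME, importable by both route files.
* `WaldspurgerKernel.openValueReciprocityAtThree_body_of_atoms (h54) (h112) : <BODY of 19281 verbatim>`.

So a planner who prefers the finer by-name supports {`thm54_bdpLalg_eq_sq_sum_heegnerPoints`,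
`prop112_shimura_maassShimuraIter_heegnerTau_mem`} over `thm54_bdpLalg_eq_sq_sum_cmValues` has the constant for that DOWN too.

HONEST FRAMING: CONDITIONAL results, re-homing only (0 defs, 0 new facts, 0 sorry); the atoms and Tate–Sen are PUBLISHED
theorems carried as named facts, NOT discharged; items 19108 ∕ 19281 are NOT closed by these theorems; nothing booked (T7);
BSD is not proved by any of this.

References: [BertoliniDarmonPrasanna2013] (1.2.9), Prop. 1.12 (1), Thm. 5.4 (5.1.12), (5.1.15)–(5.1.16); [Shimura1975Arith];
[BrinonConrad2009] Thm. 2.2.7; tree originals p536013, p533067; cell files STATUS RULING 21 (A), plan/HSIEHDOWN/README.md.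
-/

noncomputable section

open scoped NumberField BigOperators
open NumberField IsDedekindDomain
open Literature.NumberTheory.GaloisRepresentations
open Literature.NumberTheory.EllipticCurves
open Literature.NumberTheory.EllipticCurves.ModularForms
open Literature.NumberTheory.EllipticCurves.BertoliniDarmonPrasanna2013

namespace Summit.BirchSwinnertonDyer.BirchSwinnertonDyer.Theorems

namespace WaldspurgerKernel

/-- (private re-homing of `Theorems.thm54_bdpLalg_eq_sq_sum_cmValues_of_atoms`, p536013 — same statement, same proof)
**The square-root-shape fact `thm54_bdpLalg_eq_sq_sum_cmValues` FOLLOWS from its two printed atoms**: Thm. 5.4 (5.1.12)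
read at the Heegner points (`thm54_bdpLalg_eq_sq_sum_heegnerPoints`) and Prop. 1.12 (1) = Shimura's algebraicity of the
Shimura–Maass derivatives at those points (`prop112_shimura_maassShimuraIter_heegnerTau_mem`). Proof: the `χ`-free
coefficient of the ideal `𝔞` is `V_𝔞 := ∑_{i : 𝔞_i = 𝔞} a_i·(δ_2^{n−1}f)(τ_{Q_i})/Ω^{2n}` (in `F`), the period is `κ·Ω`,
and `L_alg(κΩ) = L_alg(1)/(κΩ)^{4n}`.
[cite: BertoliniDarmonPrasanna2013, Thm. 5.4 (5.1.12) (p. 59), (5.1.15)–(5.1.16) (p. 60), Prop. 1.12 (1) (p. 14)] -/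
private theorem thm54_bdpLalg_eq_sq_sum_cmValues_of_atoms (h1 : thm54_bdpLalg_eq_sq_sum_heegnerPoints)
    (h2 : prop112_shimura_maassShimuraIter_heegnerTau_mem) : thm54_bdpLalg_eq_sq_sum_cmValues := by
  intro W _ K _ _ N _ f hnf hN hK hodd hHeeg
  obtain ⟨κ, wf, bN, 𝔟, sf, hκ, hwf, hbN, ⟨e₀, x₀, hx₀⟩, h𝔟, hfam⟩ := h1 W K f hnf hN hK hodd hHeeg
  obtain ⟨Ω, F, hΩ, hFfin, hKF, hIF, hram, hmem⟩ := h2 W K f hnf hN hK hodd hHeeg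
  refine ⟨κ * Ω, wf, bN, 𝔟, sf, F, mul_ne_zero hκ hΩ, ?_, hbN, h𝔟, hFfin, hKF, hIF, ?_, ?_, hram, ?_⟩
  · rcases hwf with h | h <;> simp [h]
  · rcases hwf with h | h
    · rw [h]; exact one_mem F
    · rw [h]; exact neg_mem (one_mem F)
  · rw [← hx₀]; exact hKF e₀ x₀
  intro n hn
  obtain ⟨A, a, hA, hform⟩ := hfam n hn
  -- the χ-free coefficients `V_i := a_i · (δ^{n-1} f)(τ_i) / Ω^{2n}`, indexed by ideals after
  -- collapsing the family along `i ↦ i.1`? No: keep the family indexed by `A` itself and push it to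
  -- a Finset of ideals only if injective — instead use the ideal family `A.image Prod.fst` with
  -- coefficients summed over the fibres.
  classical
  let δf : (ℤ × ℤ × ℤ) → ℂ := fun Q ↦
    maassShimuraIter 2 (n - 1) (fun z ↦ f (UpperHalfPlane.ofComplex z)) ((heegnerTau Q : UpperHalfPlane) : ℂ)
  let V : Ideal (𝓞 K) → ℂ := fun 𝔞 ↦
    ∑ i ∈ A.filter (fun i ↦ i.1 = 𝔞), a i * δf i.2 * κ ^ (2 * n) / (κ * Ω) ^ (2 * n)
  refine ⟨A.image Prod.fst, V, ?_, ?_⟩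
  · intro 𝔞 h𝔞
    refine sum_mem fun i hi ↦ ?_
    have hiA : i ∈ A := (Finset.mem_filter.mp hi).1
    obtain ⟨hQ, -, e, y, hy⟩ := hA i hiA
    have hδ : δf i.2 / Ω ^ (2 + 2 * (n - 1)) ∈ F := hmem (n - 1) i.2 hQ
    have h2n : 2 + 2 * (n - 1) = 2 * n := by omega
    rw [h2n] at hδ
    have hrw : a i * δf i.2 * κ ^ (2 * n) / (κ * Ω) ^ (2 * n) = a i * (δf i.2 / Ω ^ (2 * n)) := by
      rw [mul_pow]
      field_simp
    rw [hrw, ← hy]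
    exact mul_mem (hKF e y) hδ
  · intro φ hunr hφ
    have hmain := hform φ hunr hφ
    -- bdpLalg at Ω' = bdpLalg at 1 divided by Ω'^{4n}
    have hscale : bdpLalg f sf wf 𝔟 N bN (κ * Ω) φ n =
        bdpLalg f sf wf 𝔟 N bN 1 φ n / (κ * Ω) ^ (4 * n) := by
      unfold bdpLalg; rw [one_pow, div_one]
    rw [hscale, hmain]
    set ρ : ℂ := κ ^ (2 * n) / (κ * Ω) ^ (2 * n) with hρ
    set T : Ideal (𝓞 K) × (ℤ × ℤ × ℤ) → ℂ := fun i ↦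
      (heckeIdealValueExtZero φ i.1 * ((Ideal.absNorm i.1 : ℕ) : ℂ) ^ n)⁻¹ * a i * δf i.2 with hT
    have hV : ∑ x ∈ A.image Prod.fst,
        (heckeIdealValueExtZero φ x * ((Ideal.absNorm x : ℕ) : ℂ) ^ n)⁻¹ * V x = ∑ i ∈ A, T i * ρ := by
      have hfib := Finset.sum_fiberwise_of_maps_to (s := A) (t := A.image Prod.fst) (g := Prod.fst)
        (fun i hi ↦ Finset.mem_image_of_mem Prod.fst hi) (fun i ↦ T i * ρ)
      rw [← hfib]
      refine Finset.sum_congr rfl fun x _ ↦ ?_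
      simp only [V, Finset.mul_sum]
      refine Finset.sum_congr rfl fun i hi ↦ ?_
      have hix : i.1 = x := (Finset.mem_filter.mp hi).2
      rw [← hix, hT, hρ]
      ring
    rw [hV, ← Finset.sum_mul, hρ]
    field_simp
    ring



/-- **The BODY of item stmt-BirchSwinnertonDyer-19108 `HsiehDescentAtThree` (both @3 route files, VERBATIM) from THREE
refereed facts BY NAME at the finest level: BDP13 Thm. 5.4 (5.1.12) at the tree's Heegner points
(`thm54_bdpLalg_eq_sq_sum_heegnerPoints`), Shimura's CM algebraicity (`prop112_shimura_maassShimuraIter_heegnerTau_mem`),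
and the printed Tate–Sen theorem at `3` (`TateSenCharacterVanishing 3`).** := the atoms derivation ∘
`WaldspurgerKernel.hsiehDescentAt₃_of_thm54_of_tateSen`. Theses-free, so citable inside `closes` (δ-unfolding). CONDITIONAL
on the three named facts (NOT discharged); item 19108 is NOT closed by this theorem.
[cite: BertoliniDarmonPrasanna2013, Thm. 5.4 (5.1.12) (p. 59) and Prop. 1.12 (1) (p. 14)] [cite: BrinonConrad2009, Thm. 2.2.7] -/
theorem hsiehDescentAt₃_of_atoms_of_tateSen
    (h54 : Literature.NumberTheory.EllipticCurves.BertoliniDarmonPrasanna2013.thm54_bdpLalg_eq_sq_sum_heegnerPoints)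
    (h112 : Literature.NumberTheory.EllipticCurves.BertoliniDarmonPrasanna2013.prop112_shimura_maassShimuraIter_heegnerTau_mem)
    (hTS : Literature.NumberTheory.PAdicHodge.TateSenCharacterVanishing 3) :
    ∀ (W : WeierstrassCurve ℚ) [W.IsElliptic] [W.IsGloballyMinimal], Summit.BirchSwinnertonDyer.Rank1Residual.ClassX11b W 3 → (Literature.NumberTheory.EllipticCurves.Rank1Residual.Ram W 3 → W.HasSplitMultiplicativeReductionAtPrime 3 → Summit.BirchSwinnertonDyer.Rank1Residual.X11b.Three.HsiehDescentAt₃ W) ∧ (¬ Literature.NumberTheory.EllipticCurves.Rank1Residual.Ram W 3 → Literature.NumberTheory.EllipticCurves.Rank1Residual.Surj W 3 → Summit.BirchSwinnertonDyer.Rank1Residual.X11b.Three.HsiehDescentAt₃ W) :=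
  hsiehDescentAt₃_of_thm54_of_tateSen (thm54_bdpLalg_eq_sq_sum_cmValues_of_atoms h54 h112) hTS

/-- **The BODY of item stmt-BirchSwinnertonDyer-19281 `OpenValueReciprocityAtThree` (SHARP K5-B, VERBATIM) from the two
atoms alone** := the atoms derivation ∘ `WaldspurgerKernel.openValueReciprocityAtThree_body_of_thm54`. CONDITIONAL on the two
named facts; item 19281 is NOT closed by this theorem.
[cite: BertoliniDarmonPrasanna2013, Thm. 5.4 (5.1.12) (p. 59) and Prop. 1.12 (1) (p. 14)] -/
theorem openValueReciprocityAtThree_body_of_atoms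
    (h54 : Literature.NumberTheory.EllipticCurves.BertoliniDarmonPrasanna2013.thm54_bdpLalg_eq_sq_sum_heegnerPoints)
    (h112 : Literature.NumberTheory.EllipticCurves.BertoliniDarmonPrasanna2013.prop112_shimura_maassShimuraIter_heegnerTau_mem) :
    ∀ (W : WeierstrassCurve ℚ) [W.IsElliptic] [W.IsGloballyMinimal], ∀ (ι' : PadicAlgCl 3 ≃+* ℂ) (K : Type) [Field K] [NumberField K] (𝔭 : IsDedekindDomain.HeightOneSpectrum (NumberField.RingOfIntegers K)) (κ : Literature.NumberTheory.EllipticCurves.ZpExtension K 3) {N : ℕ} [NeZero N] (f : CuspForm (CongruenceSubgroup.Gamma0 N) 2), Literature.NumberTheory.EllipticCurves.ModularForms.IsNewformOf W f → Summit.BirchSwinnertonDyer.Rank1Residual.ClassX11b W 3 → Literature.NumberTheory.EllipticCurves.Rank1Residual.Surj W 3 → W.conductorNorm ℤ = N → Literature.NumberTheory.EllipticCurves.IsImaginaryQuadratic K → Odd (NumberField.discr K) → Literature.NumberTheory.EllipticCurves.SatisfiesHeegnerHypothesis N K → ((Ideal.span {(3 : ℤ)}).primesOver (NumberField.RingOfIntegers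 K)).ncard = 2 → ((3 : ℕ) : NumberField.RingOfIntegers K) ∈ 𝔭.asIdeal → 𝔭.asIdeal.ramificationIdx (NumberField.RingOfIntegers ℚ) = 1 → 𝔭.asIdeal.inertiaDeg (NumberField.RingOfIntegers ℚ) = 1 → (∀ (w : NumberField.InfinitePlace K) (k : NumberField.RingOfIntegers K), k ∈ 𝔭.asIdeal ↔ ‖ι'.symm (w.embedding (k : K))‖ < 1) → (∀ ℓ : ℕ, ℓ.Prime → ℓ ∣ N → ∃ v : IsDedekindDomain.HeightOneSpectrum (NumberField.RingOfIntegers K), Ideal.absNorm v.asIdeal = ℓ) → κ.IsAnticyclotomic → ∃ Ω : ℂ, Ω ≠ 0 ∧ ∃ m : ℕ, 0 < m ∧ ¬ 3 ∣ m ∧ (∀ (τ : PadicAlgCl 3 ≃ₐ[ℚ_[3]] PadicAlgCl 3) (σ : ℂ ≃ₐ[ℚ] ℂ), (∀ ζ : PadicAlgCl 3, ζ ^ m = 1 → τ ζ = ζ) → (∀ z : PadicAlgCl 3, σ (ι' z) = ι' (τ z)) → ∀ (χ : Literature.NumberTheory.GaloisRepresentations.HeckeCharacter K) (n : ℕ),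 0 < n → (∀ v : IsDedekindDomain.HeightOneSpectrum (NumberField.RingOfIntegers K), χ.IsUnramifiedAt v) → ∀ hχ : χ.HasInfinityType (fun _ ↦ (n : ℤ)) (fun _ ↦ -(n : ℤ)), ∀ r : Literature.NumberTheory.GaloisRepresentations.FramedGaloisRep K (PadicAlgCl 3) 1, Literature.NumberTheory.EllipticCurves.IsPAdicAvatarOf ι' χ r → Literature.NumberTheory.EllipticCurves.FactorsThroughZp κ r → σ (Literature.NumberTheory.EllipticCurves.bdpInterpolationValue 3 f 𝔭 χ n Ω) = Literature.NumberTheory.EllipticCurves.bdpInterpolationValue 3 f 𝔭 (hχ.autConj σ) n Ω) :=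
  openValueReciprocityAtThree_body_of_thm54 (thm54_bdpLalg_eq_sq_sum_cmValues_of_atoms h54 h112)

end WaldspurgerKernel

end Summit.BirchSwinnertonDyer.BirchSwinnertonDyer.Theorems

end
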